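import Mathlib.Analysis.SpecialFunctions.Complex.Circle
import Literature.Analysis.FluidPDE.Axisymmetric
import HarnessLib

/-!
# Liu–Zhang 2023/2024: global strong solutions for large Fourier-mode data (3-D Navier–Stokes)

Topic `Literature/Analysis/FluidPDE`; two named facts (results in print that the tree has not
proved, `def … : Prop`, D-0014) with their vocabulary and proved API, typed for the blow-up
scenario census of cell `pub/ns-census` (row **F13N** «N-fold single-mode data, profiles in `ℳ`,
swirl `O(1/N)`, `N > N₀(‖profiles‖)` ⇒ global strong solution, NO smallness of the profiles»,
EXCLUDED-IN-PRINT-NOT-TREE; it is the printed neighbour of the OPEN rows F13m / F13mLarge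
`Summit.…ScenarioCensus.Row_F13m`, forward Clay data with an `m`-fold rotational symmetry).

Y. Liu, P. Zhang, *On the global stability of large Fourier mode for 3-D Navier–Stokes
equations*, Adv. Math. (2024) = arXiv:2305.05272 [`LiuZhang2023`].  System (1.1): (NS) on
`ℝ⁺ × ℝ³` with `ν = 1`, no force; cylindrical coordinates `x = (r cos θ, r sin θ, z)`, frame
`e_r = (cos θ, sin θ, 0)`, `e_θ = (-sin θ, cos θ, 0)`, `e_z = (0, 0, 1)` (p. 3); all `L^p` norms
are norms of `L^p(ℝ³)` (p. 4 after (1.15), p. 5 Notations: `r dr dθ dz`).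

> **Theorem 1.1** (p. 4).  Let
> `ℳ := {f(r,z) : ‖f‖_ℳ := ‖r^{1/2} f‖_{L⁶} + ‖f‖_{L²} + ‖(∂_r f, ∂_z f)‖_{L²} + ‖r⁻¹ f‖_{L²} < ∞}` (1.15).
> Then for any `(a^r, a^θ, a^z, b^r, b^θ, b^z) ∈ ℳ` satisfying
> `∂_r a^r + a^r/r + ∂_z a^z + b^θ/r = 0`, `∂_r b^r + b^r/r + ∂_z b^z - a^θ/r = 0` (1.16),
> there exists an integer `N₀ > 0` depending only on `‖(a^r, a^θ, a^z, b^r, b^θ, b^z)‖_ℳ` such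
> that for any integer `N > N₀`, the system (1.1) with initial data
> `u^r_in = a^r(r,z) cos Nθ + b^r(r,z) sin Nθ`, `u^θ_in = N⁻¹ (a^θ(r,z) cos Nθ + b^θ(r,z) sin Nθ)`,
> `u^z_in = a^z(r,z) cos Nθ + b^z(r,z) sin Nθ` (1.17)
> has a unique global strong solution [expanded in the modes `kN`, (1.18), with the decay bounds
> (1.19); Prop. 2.2 p. 8: the strong class is `u ∈ L^∞(ℝ⁺; H¹)`, `∇u ∈ L²(ℝ⁺; H¹)`].

> **Remark 1.2 (1)** (p. 4): "axisymmetric data without swirl corresponds to the case `N = 0` …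
> for the intermediate case when `N ∈ {1, ⋯, N₀}`, the global well-posedness … leaves open."

> **Theorem 1.2** (pp. 4–5).  Let `ū^r_in(r,z) e_r + ū^z_in(r,z) e_z ∈ H²(ℝ³)` and
> `Υ_k := (a^r_k, a^θ_k, a^z_k, b^r_k, b^θ_k, b^z_k) ∈ ℳ`, which satisfy (1.16) and
> `Σ_{k≥1} ‖Υ_k‖_{L³}^{3/2} < ∞` (1.21).  Then there exists an integer `N₀ > 0` such that for any
> integers `N₁, N₂, ⋯ > N₀`, the system (1.1) has a unique global strong solution with initial data
> `u^r_in = ū^r_in + Σ_k (a^r_k cos N_kθ + b^r_k sin N_kθ)`,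
> `u^θ_in = Σ_k N_k⁻¹ (a^θ_k cos N_kθ + b^θ_k sin N_kθ)`,
> `u^z_in = ū^z_in + Σ_k (a^z_k cos N_kθ + b^z_k sin N_kθ)` (1.22).
> **Remark 1.3 (1)** (p. 5): "(1.21) holds automatically if `{Υ_k}` is a finite sequence."

* `LiuZhang2023.angularPhase N x = ((x₀ + i x₁)/r)^N = e^{iNθ}` and its real/imaginary parts
  `cosMode N x = cos Nθ`, `sinMode N x = sin Nθ` (junk `0` on the axis for `N ≥ 1`);
* `LiuZhang2023.MemM f` — membership of an axisymmetric scalar `f = f(r,z)` in the class `ℳ`;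
* `LiuZhang2023.Profiles` — a sextuple `(a^r, b^r, a^θ, b^θ, a^z, b^z)` of profiles, and
  `LiuZhang2023.singleModeDatum N Υ` — the datum (1.17) / the `k`-th summand of (1.22);
* `LiuZhang2023_largeFourierMode_global` — **Theorem 1.1** as a named fact;
* `LiuZhang2023_largeFourierModes_noSwirlMean_global` — **Theorem 1.2** for FINITE families
  (Remark 1.3 (1)) as a named fact.

## Rendering (never stronger than print)

* Profiles `f(r,z)` are axisymmetric scalars on `ℝ³` (`IsAxisymmetricScalar f`: invariant under
  all rotations `rotZ θ` about the `x₂`-axis, i.e. functions of `(r, z) = (cylRadius x, x 2)`), and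
  `‖f‖_ℳ < ∞` is the conjunction `r^{1/2} f ∈ L⁶(ℝ³)`, `f ∈ H¹(ℝ³)` (`MemSobolevDomain 1 2 ⊤ volume f`
  — for an axisymmetric scalar `|∇f|² = (∂_r f)² + (∂_z f)²`, so this is `‖f‖_{L²} + ‖(∂_r f, ∂_z f)‖_{L²}
  < ∞` verbatim), `r⁻¹ f ∈ L²(ℝ³)`; `cos Nθ + i sin Nθ = ((x₀ + i x₁)/r)^N` avoids an angle function.
* The census frame (that of `Row_F0` / `Row_F13m`): print proves EXISTENCE and uniqueness of a
  global strong solution from the datum; the facts below say that a CLASSICAL solution on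
  `ℝ³ × [0, T)` which is Leray–Hopf on `[0, T)` with a rapidly decaying datum EQUAL to (1.17)
  (resp. (1.22)) extends past `T` (`HasSmoothExtensionPast`).  This is print composed with the two
  textbook facts used throughout the census frame — weak–strong uniqueness (the classical
  Leray–Hopf solution coincides on `[0, T)` with the global strong solution, which lies in
  `L^∞H¹ ∩ L²H² ⊂ L⁴_t L^∞_x`) and interior smoothness of strong solutions — and it restricts the
  data to the smooth rapidly decaying ones (a special case); uniqueness and the decay bounds
  (1.18)–(1.19) are not restated.
* Viscosity: print has `ν = 1`; for `ν > 0` the field `v(t, x) := ν⁻¹ u(ν⁻¹ t, x)` solves (1.1) with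
  `ν = 1` and datum `ν⁻¹ u_in`, again of the form (1.17) with profiles `ν⁻¹(a, b) ∈ ℳ`; so the
  facts quantify `∀ ν > 0, ∀ profiles, ∃ N₀, …` — `N₀` may depend on `ν` and on the profiles
  themselves (print: on `‖(a, b)‖_ℳ` only), which is weaker than print.
* The constraint (1.16) "guarantees that `div u_in = 0`" (p. 4) and is equivalent to it for data
  (1.17) (one angular frequency `N ≥ 1`); in the census frame `div u(0) = 0` is part of
  `IsClassicalNSSolutionOn` at `t = 0`, so (1.16) is not a separate hypothesis.  In Thm 1.2 the
  frequencies are taken pairwise DISTINCT (`Function.Injective`), so that `div u_in = 0` splits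
  into (1.16) for the mean (frequency `0`) and for each `Υ_k` by orthogonality of the angular
  modes; print allows repetitions (merge equal frequencies), so this is again a special case.
* Thm 1.2 is rendered for finite families `k < K` only (Remark 1.3 (1): then (1.21) is automatic);
  the mean flow is an axisymmetric swirl-free field `U ∈ H²(ℝ³)` (`IsAxisymmetric U`,
  `HasNoSwirl U`, `MemSobolevDomain 2 2 ⊤ volume U`) — print's `ū^r_in(r,z) e_r + ū^z_in(r,z) e_z`.
  -- TODO(general form): countable families under (1.21); Remark 1.3 (2) (any globally
  -- well-posed datum in place of the swirl-free mean, via Gallagher–Iftimie–Planchon 2003).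

## Mathlib / tree search

`lean search 'LiuZhang|largeFourierMode|singleMode|cosMode'` (2026-08-28): no declaration for the
result; `cosMode` exists only on tori (`FractalHomogenization…`, other namespace).  Reused:
`rotZ`, `cylRadius`, `eR`, `eTheta`, `eZ`, `IsAxisymmetric`, `IsAxisymmetricScalar`, `HasNoSwirl`
(`AxisymmetricEuler.lean`), `IsClassicalNSSolutionOn`, `HasSmoothExtensionPast`
(`ClassicalSolution.lean`), `IsLerayHopfOn` (`LerayHopf.lean`), `HasRapidSpatialDecay`
(`NSWave0.lean`), `MemSobolevDomain` (`FunctionSpaces/SobolevDomain.lean`).  Neighbours: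
`axisymmetric_no_swirl_global_regularity` (row F3, the case `N = 0`),
`Summit.…ScenarioCensus.Row_F13m` (OPEN; the `C_N`-symmetric Clay data — every datum (1.17) is
`C_N`-symmetric, `LiuZhang2023.singleModeDatum_rotZ_two_pi_div`).

## References

* Y. Liu, P. Zhang, arXiv:2305.05272 (Adv. Math. 2024): §1 (1.1), (1.15)–(1.22), Thm 1.1, Rem 1.2,
  Thm 1.2, Rem 1.3 (pp. 3–5); Thm 2.1 (ii) (`2π/m`-periodicity persists, p. 6); Prop 2.2 (p. 8);
  §6 (proof of Thm 1.2, pp. 26–27). [`LiuZhang2023`]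
* O. A. Ladyzhenskaya 1968; M. R. Ukhovskii, V. I. Iudovich 1968 (the swirl-free case `N = 0`).
-/

noncomputable section

open MeasureTheory Set Function Filter Topology TopologicalSpace
open scoped NNReal ENNReal

namespace Literature.Analysis.FluidPDE

namespace LiuZhang2023

/-! ### Angular modes without an angle function -/

/-- The angular phase `e^{iNθ} = ((x₀ + i x₁)/r)^N` of a point `x = (r cos θ, r sin θ, z)` off the
axis (Liu–Zhang, p. 3: `x = (r cos θ, r sin θ, z)`; the modes `cos Nθ`, `sin Nθ` of (1.17)).  Junk
value on the axis `r = 0`: `(0/0)^N = 0` for `N ≥ 1` (`1` for `N = 0`).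
[cite: LiuZhang2023, §1 p. 3 (cylindrical coordinates) and (1.17)] -/
def angularPhase (N : ℕ) (x : EuclideanSpace ℝ (Fin 3)) : ℂ :=
  (((x 0 : ℂ) + (x 1 : ℂ) * Complex.I) / (cylRadius x : ℂ)) ^ N

/-- `cos Nθ` as a function on `ℝ³` (real part of the angular phase). [cite: LiuZhang2023, (1.17)] -/
def cosMode (N : ℕ) (x : EuclideanSpace ℝ (Fin 3)) : ℝ :=
  (angularPhase N x).re

/-- `sin Nθ` as a function on `ℝ³` (imaginary part of the angular phase). [cite: LiuZhang2023, (1.17)] -/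
def sinMode (N : ℕ) (x : EuclideanSpace ℝ (Fin 3)) : ℝ :=
  (angularPhase N x).im

/-- `x₀ + i x₁` has modulus `r`. [cite: LiuZhang2023, §1 p. 3 (r = √(x₁² + x₂²))] -/
theorem norm_planarComplex (x : EuclideanSpace ℝ (Fin 3)) :
    ‖(x 0 : ℂ) + (x 1 : ℂ) * Complex.I‖ = cylRadius x := by
  have h : ((x 0 : ℂ) + (x 1 : ℂ) * Complex.I) = (⟨x 0, x 1⟩ : ℂ) := by
    apply Complex.ext <;> simp
  rw [h, Complex.norm_eq_sqrt_sq_add_sq, cylRadius]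

/-- Off the axis the angular phase is unimodular: `|e^{iNθ}| = 1`. [cite: LiuZhang2023, (1.17)] -/
theorem norm_angularPhase {x : EuclideanSpace ℝ (Fin 3)} (hx : cylRadius x ≠ 0) (N : ℕ) :
    ‖angularPhase N x‖ = 1 := by
  rw [angularPhase, norm_pow, norm_div, norm_planarComplex, Complex.norm_real, Real.norm_eq_abs,
    abs_of_nonneg (cylRadius_nonneg x), div_self hx, one_pow]

/-- Off the axis `cos² Nθ + sin² Nθ = 1`. [cite: LiuZhang2023, (1.17)] -/
theorem cosMode_sq_add_sinMode_sq {x : EuclideanSpace ℝ (Fin 3)} (hx : cylRadius x ≠ 0) (N : ℕ) :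
    cosMode N x ^ 2 + sinMode N x ^ 2 = 1 := by
  have h := norm_angularPhase hx N
  rw [Complex.norm_eq_sqrt_sq_add_sq, Real.sqrt_eq_one] at h
  simpa [cosMode, sinMode] using h

/-- On the axis the angular phase takes the junk value `0` for `N ≥ 1` (so the datum (1.17) is `0`
there, as it must be for a continuous single-mode field). [cite: LiuZhang2023, (1.17)] -/
theorem angularPhase_of_cylRadius_eq_zero {x : EuclideanSpace ℝ (Fin 3)} (hx : cylRadius x = 0)
    {N : ℕ} (hN : N ≠ 0) : angularPhase N x = 0 := by
  rw [angularPhase, hx, Complex.ofReal_zero, div_zero, zero_pow hN]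

/-- Rotating the point by `φ` about the axis multiplies `x₀ + i x₁` by `e^{iφ}`.
[cite: LiuZhang2023, Thm 2.1 (ii) (rotation θ ↦ θ + 2π/m)] -/
theorem planarComplex_rotZ (φ : ℝ) (x : EuclideanSpace ℝ (Fin 3)) :
    ((rotZ φ x 0 : ℂ) + (rotZ φ x 1 : ℂ) * Complex.I) =
      Complex.exp (φ * Complex.I) * ((x 0 : ℂ) + (x 1 : ℂ) * Complex.I) := by
  rw [Complex.exp_mul_I]
  apply Complex.ext
  · simp [Complex.cos_ofReal_re, Complex.sin_ofReal_re]
  · simp [Complex.cos_ofReal_re, Complex.sin_ofReal_re, Complex.cos_ofReal_im,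
      Complex.sin_ofReal_im]
    ring

/-- Rotation by `φ` multiplies the angular phase by `e^{iNφ}`:
`e^{iN(θ+φ)} = e^{iNφ} e^{iNθ}`. [cite: LiuZhang2023, Thm 2.1 (ii)] -/
theorem angularPhase_rotZ (N : ℕ) (φ : ℝ) (x : EuclideanSpace ℝ (Fin 3)) :
    angularPhase N (rotZ φ x) = Complex.exp (N * φ * Complex.I) * angularPhase N x := by
  rw [angularPhase, angularPhase, planarComplex_rotZ, cylRadius_rotZ, mul_div_assoc, mul_pow,
    ← Complex.exp_nat_mul]
  ring_nf

/-- The angular phase of frequency `N ≥ 1` is invariant under the rotation by `2π/N`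
(the `2π/N`-periodicity in `θ` of the datum (1.17), Liu–Zhang Thm 2.1 (ii) / p. 8).
[cite: LiuZhang2023, Thm 2.1 (ii) and p. 8 ("still keeps 2π/N-periodic in θ variable")] -/
theorem angularPhase_rotZ_two_pi_div {N : ℕ} (hN : N ≠ 0) (x : EuclideanSpace ℝ (Fin 3)) :
    angularPhase N (rotZ (2 * Real.pi / N) x) = angularPhase N x := by
  rw [angularPhase_rotZ]
  have hN' : (N : ℂ) ≠ 0 := Nat.cast_ne_zero.mpr hN
  have h : (N : ℂ) * ((2 * Real.pi / N : ℝ) : ℂ) * Complex.I = 2 * Real.pi * Complex.I := by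
    push_cast
    field_simp
  rw [h, Complex.exp_two_pi_mul_I, one_mul]

/-- Hence `cos Nθ` is `C_N`-invariant. [cite: LiuZhang2023, Thm 2.1 (ii)] -/
theorem cosMode_rotZ_two_pi_div {N : ℕ} (hN : N ≠ 0) (x : EuclideanSpace ℝ (Fin 3)) :
    cosMode N (rotZ (2 * Real.pi / N) x) = cosMode N x := by
  rw [cosMode, cosMode, angularPhase_rotZ_two_pi_div hN]

/-- Hence `sin Nθ` is `C_N`-invariant. [cite: LiuZhang2023, Thm 2.1 (ii)] -/
theorem sinMode_rotZ_two_pi_div {N : ℕ} (hN : N ≠ 0) (x : EuclideanSpace ℝ (Fin 3)) :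
    sinMode N (rotZ (2 * Real.pi / N) x) = sinMode N x := by
  rw [sinMode, sinMode, angularPhase_rotZ_two_pi_div hN]

/-! ### The class `ℳ` and the single-mode data -/

/-- **The class `ℳ` of (1.15)** for a profile `f = f(r, z)`, regarded as an axisymmetric scalar
function on `ℝ³`: `‖r^{1/2} f‖_{L⁶(ℝ³)} + ‖f‖_{L²(ℝ³)} + ‖(∂_r f, ∂_z f)‖_{L²(ℝ³)} + ‖r⁻¹ f‖_{L²(ℝ³)}
< ∞`, rendered as: `f` is invariant under the rotations about the axis, `r^{1/2} f ∈ L⁶`,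
`f ∈ H¹(ℝ³)` (weakly; `= ‖f‖_{L²} + ‖(∂_r f, ∂_z f)‖_{L²} < ∞` for axisymmetric `f`), `r⁻¹ f ∈ L²`.
[cite: LiuZhang2023, Thm 1.1 (1.15)] -/
def MemM (f : EuclideanSpace ℝ (Fin 3) → ℝ) : Prop :=
  IsAxisymmetricScalar f ∧
    MemLp (fun x => Real.sqrt (cylRadius x) * f x) 6 volume ∧
    FunctionSpaces.MemSobolevDomain 1 2 (⊤ : Opens (EuclideanSpace ℝ (Fin 3))) volume f ∧
    MemLp (fun x => (cylRadius x)⁻¹ * f x) 2 volume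

/-- A sextuple of profiles `Υ = (a^r, b^r, a^θ, b^θ, a^z, b^z)`, each a function of `(r, z)` written
as a scalar function on `ℝ³` (Liu–Zhang, Thm 1.1 and `Υ_k` of Thm 1.2).
[cite: LiuZhang2023, Thm 1.1 and Thm 1.2 (the profiles (a^r,a^θ,a^z,b^r,b^θ,b^z))] -/
structure Profiles where
  /-- `a^r(r, z)`, the `cos Nθ` coefficient of `u^r_in`. -/
  ar : EuclideanSpace ℝ (Fin 3) → ℝ
  /-- `b^r(r, z)`, the `sin Nθ` coefficient of `u^r_in`. -/
  br : EuclideanSpace ℝ (Fin 3) → ℝ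
  /-- `a^θ(r, z)`, the `cos Nθ` coefficient of `N u^θ_in`. -/
  aθ : EuclideanSpace ℝ (Fin 3) → ℝ
  /-- `b^θ(r, z)`, the `sin Nθ` coefficient of `N u^θ_in`. -/
  bθ : EuclideanSpace ℝ (Fin 3) → ℝ
  /-- `a^z(r, z)`, the `cos Nθ` coefficient of `u^z_in`. -/
  az : EuclideanSpace ℝ (Fin 3) → ℝ
  /-- `b^z(r, z)`, the `sin Nθ` coefficient of `u^z_in`. -/
  bz : EuclideanSpace ℝ (Fin 3) → ℝ

/-- `(a^r, a^θ, a^z, b^r, b^θ, b^z) ∈ ℳ`: every profile lies in the class `ℳ` of (1.15).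
[cite: LiuZhang2023, Thm 1.1 ("for any (a^r,a^θ,a^z,b^r,b^θ,b^z) ∈ ℳ")] -/
def Profiles.MemM (Υ : Profiles) : Prop :=
  LiuZhang2023.MemM Υ.ar ∧ LiuZhang2023.MemM Υ.br ∧ LiuZhang2023.MemM Υ.aθ ∧
    LiuZhang2023.MemM Υ.bθ ∧ LiuZhang2023.MemM Υ.az ∧ LiuZhang2023.MemM Υ.bz

/-- **The single-mode datum (1.17)** at angular frequency `N` with profiles `Υ`:
`u_in = (a^r cos Nθ + b^r sin Nθ) e_r + N⁻¹ (a^θ cos Nθ + b^θ sin Nθ) e_θ + (a^z cos Nθ + b^z sin Nθ) e_z`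
(also the summand `w_{k,in}` of (1.22) / §6).  On the axis the frame vectors `eR`, `eTheta` and the
modes carry junk value `0`. [cite: LiuZhang2023, Thm 1.1 (1.17); §6 (w_{k,in})] -/
def singleModeDatum (N : ℕ) (Υ : Profiles) (x : EuclideanSpace ℝ (Fin 3)) :
    EuclideanSpace ℝ (Fin 3) :=
  (Υ.ar x * cosMode N x + Υ.br x * sinMode N x) • eR x +
    ((N : ℝ)⁻¹ * (Υ.aθ x * cosMode N x + Υ.bθ x * sinMode N x)) • eTheta x +
    (Υ.az x * cosMode N x + Υ.bz x * sinMode N x) • eZ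

/-- Rotations about the axis are additive. [folklore] -/
private theorem rotZ_add_vec' (θ : ℝ) (x y : EuclideanSpace ℝ (Fin 3)) :
    rotZ θ (x + y) = rotZ θ x + rotZ θ y := by
  ext i
  fin_cases i <;> simp [rotZ] <;> ring

/-- Rotations about the axis commute with scalar multiplication. [folklore] -/
private theorem rotZ_smul_vec' (θ c : ℝ) (x : EuclideanSpace ℝ (Fin 3)) :
    rotZ θ (c • x) = c • rotZ θ x := by
  ext i
  fin_cases i <;> simp [rotZ] <;> ring

/-- `e_r` is rotation-equivariant. [folklore] -/
private theorem eR_rotZ' (θ : ℝ) (x : EuclideanSpace ℝ (Fin 3)) : eR (rotZ θ x) = rotZ θ (eR x) := by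
  ext i
  fin_cases i <;> simp [eR, cylRadius_rotZ] <;> ring

/-- `e_θ` is rotation-equivariant. [folklore] -/
private theorem eTheta_rotZ' (θ : ℝ) (x : EuclideanSpace ℝ (Fin 3)) :
    eTheta (rotZ θ x) = rotZ θ (eTheta x) := by
  ext i
  fin_cases i <;> simp [eTheta, cylRadius_rotZ] <;> ring

/-- `e_z` is fixed by the rotations. [folklore] -/
private theorem rotZ_eZ' (θ : ℝ) : rotZ θ (eZ : EuclideanSpace ℝ (Fin 3)) = eZ := by
  ext i
  fin_cases i <;> simp [rotZ, eZ]

/-- **The datum (1.17) is `C_N`-symmetric**: `u_in (R_{2π/N} x) = R_{2π/N} (u_in x)` for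
`N ≥ 1` and axisymmetric profiles — the symmetry hypothesis of the census row `Row_F13m N`
(Liu–Zhang Thm 2.1 (ii): the datum, and then the solution, is `2π/N`-periodic in `θ`).
[cite: LiuZhang2023, Thm 2.1 (ii) and p. 8] -/
theorem singleModeDatum_rotZ_two_pi_div {N : ℕ} (hN : N ≠ 0) {Υ : Profiles}
    (har : IsAxisymmetricScalar Υ.ar) (hbr : IsAxisymmetricScalar Υ.br)
    (haθ : IsAxisymmetricScalar Υ.aθ) (hbθ : IsAxisymmetricScalar Υ.bθ)
    (haz : IsAxisymmetricScalar Υ.az) (hbz : IsAxisymmetricScalar Υ.bz)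
    (x : EuclideanSpace ℝ (Fin 3)) :
    singleModeDatum N Υ (rotZ (2 * Real.pi / N) x) = rotZ (2 * Real.pi / N) (singleModeDatum N Υ x) := by
  simp only [singleModeDatum, rotZ_add_vec', rotZ_smul_vec', eR_rotZ', eTheta_rotZ', rotZ_eZ',
    cosMode_rotZ_two_pi_div hN, sinMode_rotZ_two_pi_div hN, har _ x, hbr _ x, haθ _ x, hbθ _ x,
    haz _ x, hbz _ x]

/-- The same under the bundled hypothesis `Υ.MemM` (each profile in `ℳ` is axisymmetric).
[cite: LiuZhang2023, Thm 2.1 (ii)] -/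
theorem singleModeDatum_rotZ_two_pi_div_of_memM {N : ℕ} (hN : N ≠ 0) {Υ : Profiles}
    (hΥ : Υ.MemM) (x : EuclideanSpace ℝ (Fin 3)) :
    singleModeDatum N Υ (rotZ (2 * Real.pi / N) x) = rotZ (2 * Real.pi / N) (singleModeDatum N Υ x) :=
  singleModeDatum_rotZ_two_pi_div hN hΥ.1.1 hΥ.2.1.1 hΥ.2.2.1.1 hΥ.2.2.2.1.1 hΥ.2.2.2.2.1.1
    hΥ.2.2.2.2.2.1 x

end LiuZhang2023

open LiuZhang2023

/-! ### The named facts -/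

/-- **Liu–Zhang, Theorem 1.1 (global strong solutions for large single-Fourier-mode data, no
smallness of the profiles).**  "for any `(a^r, a^θ, a^z, b^r, b^θ, b^z) ∈ ℳ` satisfying (1.16),
there exists an integer `N₀ > 0` depending only on `‖(a^r, …, b^z)‖_ℳ` such that for any integer
`N > N₀`, the system (1.1) with initial data (1.17) has a unique global strong solution"
(`u ∈ L^∞(ℝ⁺; H¹)`, `∇u ∈ L²(ℝ⁺; H¹)`, Prop 2.2).  Rendered (module docstring) in the census frame:
for `ν > 0` and profiles `Υ ∈ ℳ` there is `N₀` such that for every `N > N₀`, every classical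
solution of the unforced system on `ℝ³ × [0, T)` which is Leray–Hopf on `[0, T)`, with rapidly
decaying datum `u 0` EQUAL to the single-mode datum (1.17) of frequency `N`, extends past `T`
(print ∘ weak–strong uniqueness ∘ smoothness of strong solutions; (1.16) ⇔ `div u(0) = 0` is in
the frame; `ν` by scaling).  Statement only; users take `(h : LiuZhang2023_largeFourierMode_global)`.
[cite: LiuZhang2023, Thm 1.1 (arXiv:2305.05272 p. 4, (1.15)–(1.17)); Prop 2.2 (p. 8)] -/
def LiuZhang2023_largeFourierMode_global : Prop :=
  ∀ (ν : ℝ), 0 < ν → ∀ (Υ : Profiles), Υ.MemM →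
    ∃ N₀ : ℕ, ∀ N : ℕ, N₀ < N →
      ∀ (T : ℝ), 0 < T →
      ∀ (u : ℝ → EuclideanSpace ℝ (Fin 3) → EuclideanSpace ℝ (Fin 3))
        (p : ℝ → EuclideanSpace ℝ (Fin 3) → ℝ),
        IsClassicalNSSolutionOn (Ico 0 T) ν 0 u p → IsLerayHopfOn T ν 0 (u 0) u →
        HasRapidSpatialDecay (u 0) →
        u 0 = singleModeDatum N Υ →
        HasSmoothExtensionPast ν 0 u T

/-- **Liu–Zhang, Theorem 1.2 (swirl-free axisymmetric mean plus finitely many large modes), the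
finite-family case of Remark 1.3 (1).**  "Let `ū^r_in(r,z) e_r + ū^z_in(r,z) e_z ∈ H²(ℝ³)` and
`Υ_k ∈ ℳ`, which satisfy (1.16) and `Σ_k ‖Υ_k‖_{L³}^{3/2} < ∞`.  Then there exists an integer `N₀ > 0`
such that for any integers `N₁, N₂, ⋯ > N₀`, the system (1.1) has a unique global strong solution
with initial data (1.22)" — "(1.21) holds automatically if `{Υ_k}` is a finite sequence".  Rendered
(module docstring): for `ν > 0`, an axisymmetric swirl-free mean flow `U ∈ H²(ℝ³)` and profiles
`Υ_0, …, Υ_{K-1} ∈ ℳ` there is `N₀` such that for all pairwise distinct frequencies `N_k > N₀`,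
every classical Leray–Hopf solution on `ℝ³ × [0, T)` with rapidly decaying datum
`u 0 = U + Σ_{k<K} singleModeDatum (N_k) (Υ_k)` extends past `T`.  Statement only; users take
`(h : LiuZhang2023_largeFourierModes_noSwirlMean_global)`.
-- TODO(general form): countable families with `Σ_k ‖Υ_k‖_{L³}^{3/2} < ∞` (1.21); repeated
-- frequencies; Remark 1.3 (2).
[cite: LiuZhang2023, Thm 1.2 with Rem 1.3 (1) (arXiv:2305.05272 pp. 4–5, (1.21)–(1.22)); §6 pp. 26–27] -/
def LiuZhang2023_largeFourierModes_noSwirlMean_global : Prop :=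
  ∀ (ν : ℝ), 0 < ν →
    ∀ (U : EuclideanSpace ℝ (Fin 3) → EuclideanSpace ℝ (Fin 3)),
      IsAxisymmetric U → HasNoSwirl U →
      FunctionSpaces.MemSobolevDomain 2 2 (⊤ : Opens (EuclideanSpace ℝ (Fin 3))) volume U →
    ∀ (K : ℕ) (Υ : Fin K → Profiles), (∀ k, (Υ k).MemM) →
    ∃ N₀ : ℕ, ∀ Nk : Fin K → ℕ, Function.Injective Nk → (∀ k, N₀ < Nk k) →
      ∀ (T : ℝ), 0 < T →
      ∀ (u : ℝ → EuclideanSpace ℝ (Fin 3) → EuclideanSpace ℝ (Fin 3))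
        (p : ℝ → EuclideanSpace ℝ (Fin 3) → ℝ),
        IsClassicalNSSolutionOn (Ico 0 T) ν 0 u p → IsLerayHopfOn T ν 0 (u 0) u →
        HasRapidSpatialDecay (u 0) →
        (u 0 = fun x => U x + ∑ k, singleModeDatum (Nk k) (Υ k) x) →
        HasSmoothExtensionPast ν 0 u T

/-! ### API -/

namespace LiuZhang2023_largeFourierMode_global

/-- Theorem 1.1 applied: the threshold `N₀` for given viscosity and profiles.
[cite: LiuZhang2023, Thm 1.1] -/
theorem exists_threshold (h : LiuZhang2023_largeFourierMode_global) {ν : ℝ} (hν : 0 < ν)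
    {Υ : Profiles} (hΥ : Υ.MemM) :
    ∃ N₀ : ℕ, ∀ N : ℕ, N₀ < N →
      ∀ (T : ℝ), 0 < T →
      ∀ (u : ℝ → EuclideanSpace ℝ (Fin 3) → EuclideanSpace ℝ (Fin 3))
        (p : ℝ → EuclideanSpace ℝ (Fin 3) → ℝ),
        IsClassicalNSSolutionOn (Ico 0 T) ν 0 u p → IsLerayHopfOn T ν 0 (u 0) u →
        HasRapidSpatialDecay (u 0) → u 0 = singleModeDatum N Υ →
        HasSmoothExtensionPast ν 0 u T :=
  h ν hν Υ hΥ

/-- **The data of Theorem 1.1 lie in row F13m's class**: under the fact, for `N > N₀(ν, Υ)` the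
classical Leray–Hopf solution from the datum (1.17) extends past `T`, AND that datum is
`C_N`-symmetric (`u₀ ∘ R_{2π/N} = R_{2π/N} ∘ u₀`) — i.e. Theorem 1.1 decides a sub-cell of the
census cell F13m at order `m = N` (it does not decide F13m: Remark 1.2 (1)).
[cite: LiuZhang2023, Thm 1.1 with Thm 2.1 (ii) and Rem 1.2 (1)] -/
theorem extends_and_symmetric (h : LiuZhang2023_largeFourierMode_global) {ν : ℝ} (hν : 0 < ν)
    {Υ : Profiles} (hΥ : Υ.MemM) :
    ∃ N₀ : ℕ, ∀ N : ℕ, N₀ < N →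
      (∀ x, singleModeDatum N Υ (rotZ (2 * Real.pi / N) x) = rotZ (2 * Real.pi / N)
          (singleModeDatum N Υ x)) ∧
      ∀ (T : ℝ), 0 < T →
      ∀ (u : ℝ → EuclideanSpace ℝ (Fin 3) → EuclideanSpace ℝ (Fin 3))
        (p : ℝ → EuclideanSpace ℝ (Fin 3) → ℝ),
        IsClassicalNSSolutionOn (Ico 0 T) ν 0 u p → IsLerayHopfOn T ν 0 (u 0) u →
        HasRapidSpatialDecay (u 0) → u 0 = singleModeDatum N Υ →
        HasSmoothExtensionPast ν 0 u T := by
  obtain ⟨N₀, hN₀⟩ := h ν hν Υ hΥ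
  refine ⟨N₀, fun N hN => ⟨fun x => ?_, hN₀ N hN⟩⟩
  exact singleModeDatum_rotZ_two_pi_div_of_memM (by omega) hΥ x

end LiuZhang2023_largeFourierMode_global

namespace LiuZhang2023_largeFourierModes_noSwirlMean_global

/-- **The case `K = 0` of Theorem 1.2 is the swirl-free axisymmetric case** (Remark 1.2 (1): "`N = 0`";
Ladyzhenskaya / Ukhovskii–Yudovich, row F3 of the census): under the fact, a classical Leray–Hopf
solution on `ℝ³ × [0, T)` whose rapidly decaying datum is an axisymmetric swirl-free `H²` field
extends past `T`. [cite: LiuZhang2023, Thm 1.2 with Rem 1.2 (1) (the case without modes)] -/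
theorem noSwirl (h : LiuZhang2023_largeFourierModes_noSwirlMean_global) {ν : ℝ} (hν : 0 < ν)
    {U : EuclideanSpace ℝ (Fin 3) → EuclideanSpace ℝ (Fin 3)} (hax : IsAxisymmetric U)
    (hsw : HasNoSwirl U)
    (hH2 : FunctionSpaces.MemSobolevDomain 2 2 (⊤ : Opens (EuclideanSpace ℝ (Fin 3))) volume U)
    {T : ℝ} (hT : 0 < T) {u : ℝ → EuclideanSpace ℝ (Fin 3) → EuclideanSpace ℝ (Fin 3)}
    {p : ℝ → EuclideanSpace ℝ (Fin 3) → ℝ} (hcl : IsClassicalNSSolutionOn (Ico 0 T) ν 0 u p)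
    (hLH : IsLerayHopfOn T ν 0 (u 0) u) (hdec : HasRapidSpatialDecay (u 0)) (h0 : u 0 = U) :
    HasSmoothExtensionPast ν 0 u T := by
  obtain ⟨N₀, hN₀⟩ := h ν hν U hax hsw hH2 0 (fun k => k.elim0) (fun k => k.elim0)
  refine hN₀ (fun k => k.elim0) (fun k => k.elim0) (fun k => k.elim0) T hT u p hcl hLH hdec ?_
  simpa using h0

/-- Theorem 1.2 with ONE mode (`K = 1`): swirl-free axisymmetric mean plus a single large mode.
[cite: LiuZhang2023, Thm 1.2 (one Υ_k)] -/
theorem one_mode (h : LiuZhang2023_largeFourierModes_noSwirlMean_global) {ν : ℝ} (hν : 0 < ν)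
    {U : EuclideanSpace ℝ (Fin 3) → EuclideanSpace ℝ (Fin 3)} (hax : IsAxisymmetric U)
    (hsw : HasNoSwirl U)
    (hH2 : FunctionSpaces.MemSobolevDomain 2 2 (⊤ : Opens (EuclideanSpace ℝ (Fin 3))) volume U)
    {Υ : Profiles} (hΥ : Υ.MemM) :
    ∃ N₀ : ℕ, ∀ N : ℕ, N₀ < N →
      ∀ (T : ℝ), 0 < T →
      ∀ (u : ℝ → EuclideanSpace ℝ (Fin 3) → EuclideanSpace ℝ (Fin 3))
        (p : ℝ → EuclideanSpace ℝ (Fin 3) → ℝ),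
        IsClassicalNSSolutionOn (Ico 0 T) ν 0 u p → IsLerayHopfOn T ν 0 (u 0) u →
        HasRapidSpatialDecay (u 0) → (u 0 = fun x => U x + singleModeDatum N Υ x) →
        HasSmoothExtensionPast ν 0 u T := by
  obtain ⟨N₀, hN₀⟩ := h ν hν U hax hsw hH2 1 (fun _ => Υ) (fun _ => hΥ)
  refine ⟨N₀, fun N hN T hT u p hcl hLH hdec h0 => ?_⟩
  refine hN₀ (fun _ => N) (fun a b _ => Subsingleton.elim a b) (fun _ => hN) T hT u p hcl hLH hdec ?_
  simpa using h0

end LiuZhang2023_largeFourierModes_noSwirlMean_global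

end Literature.Analysis.FluidPDE

end
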